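import Mathlib
import Summits.ValiantsHypothesis.ValiantsHypothesis.Theorems.NewtonUnitEquationsDissociatedUniformTotalsLawAntiFibres
import HarnessLib

/-!
# Crux `NewtonUnitEquations.DissociatedUniform` (stmt-ValiantsHypothesis-5905): the convex-fibre stratum is OPEN — any strictly convex
# polygon with a SMALL partner has strictly convex fibres and anti-fibres, hence the co-oriented pointwise law `V_s ≤ 4q`

Companion of `…TotalsLawAntiFibres` (pairs whose fibres `x ↦ a x + b (r − x)` and anti-fibres `x ↦ a x − b (x + κ)` are strictly convex ccw
satisfy `V_s(a, b, μ•c) ≤ 4q` in the dominant regime for every strictly convex ccw `c`).  This file proves that the stratum contains, BY NAME,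
every pair (strictly convex ccw `a`, `b` with coordinates bounded by an explicit `ε(a) > 0`):

* `StrictlyConvexCcw.add_small` — strict ccw convex position survives any perturbation with coordinates `≤ ε = min 1 (m / (64M + 32))`, `m` the
  convexity margin `min det(a(z+1) − a z, a x − a z)` and `M = Σ_x (|a x 0| + |a x 1|)`;
* **`exists_eps_fibres_convex`**: `∃ ε > 0`, every `b` with `|b y i| ≤ ε` gives strictly convex ccw fibres and anti-fibres;
* **`classVert_smallPartner_smul_le`**: for such `b` and ANY strictly convex ccw `c` (`q ≥ 3`): `∃ μ₀ ∀ μ ≥ μ₀ ∀ s, V_s(a, b, μ•c) ≤ 4q`.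
Honest label: a pointwise law on an explicit open stratum in the dominant regime; `CoOrientedClassBound`, `SmoothSharpTotalsLaw`, `TotalsLawThree`
remain OPEN; nothing here bears on VP ≠ VNP.
[folklore: strict convex position is an open condition]
-/

set_option linter.dupNamespace false -- `ValiantsHypothesis.ValiantsHypothesis` (summit = problem) in every name

open scoped BigOperators

namespace Summit.ValiantsHypothesis.ValiantsHypothesis.Theorems.NewtonUnitEquationsDissociatedUniform

namespace TotalsLaw

open Matrix Real

section SmallPartner

variable {q : ℕ} [NeZero q]

omit [NeZero q] in
/-- `|det(u, w)| ≤ (|u₀| + |u₁|)(|w₀| + |w₁|)`. [folklore] -/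
theorem abs_cross2_le (u w : Fin 2 → ℝ) : |cross2 u w| ≤ (|u 0| + |u 1|) * (|w 0| + |w 1|) := by
  rw [cross2]
  have h1 : |u 0 * w 1 - u 1 * w 0| ≤ |u 0 * w 1| + |u 1 * w 0| := abs_sub _ _
  rw [abs_mul, abs_mul] at h1
  nlinarith [abs_nonneg (u 0), abs_nonneg (u 1), abs_nonneg (w 0), abs_nonneg (w 1)]

omit [NeZero q] in
/-- `det(d + δ₁, v + δ₂) ≥ det(d, v) − (|error terms|)`. [folklore] -/
theorem cross2_add_add_ge (d v δ₁ δ₂ : Fin 2 → ℝ) :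
    cross2 d v - ((|d 0| + |d 1|) * (|δ₂ 0| + |δ₂ 1|) + (|δ₁ 0| + |δ₁ 1|) * (|v 0| + |v 1|) +
      (|δ₁ 0| + |δ₁ 1|) * (|δ₂ 0| + |δ₂ 1|)) ≤ cross2 (d + δ₁) (v + δ₂) := by
  have e : cross2 (d + δ₁) (v + δ₂) = cross2 d v + cross2 d δ₂ + cross2 δ₁ v + cross2 δ₁ δ₂ := by
    simp [cross2]; ring
  rw [e]
  have h1 := abs_cross2_le d δ₂
  have h2 := abs_cross2_le δ₁ v
  have h3 := abs_cross2_le δ₁ δ₂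
  have := neg_abs_le (cross2 d δ₂)
  have := neg_abs_le (cross2 δ₁ v)
  have := neg_abs_le (cross2 δ₁ δ₂)
  linarith

/-- The coordinate mass `M(a) = Σ_x (|a x 0| + |a x 1|)` bounds every coordinate. [folklore] -/
theorem abs_apply_le_mass (a : ZMod q → (Fin 2 → ℝ)) (x : ZMod q) (i : Fin 2) :
    |a x i| ≤ ∑ y : ZMod q, (|a y 0| + |a y 1|) := by
  have h : |a x 0| + |a x 1| ≤ ∑ y : ZMod q, (|a y 0| + |a y 1|) :=
    Finset.single_le_sum (f := fun y => |a y 0| + |a y 1|) (fun y _ => by positivity) (Finset.mem_univ x)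
  fin_cases i
  · simp only [Fin.zero_eta, Fin.isValue]; linarith [abs_nonneg (a x 1)]
  · simp only [Fin.mk_one, Fin.isValue]; linarith [abs_nonneg (a x 0)]

/-- **Strict convex position survives small perturbations.**  If `a` is strictly convex ccw with margin `m > 0`
(`m ≤ det(a(z+1) − a z, a x − a z)` for `x ∉ {z, z+1}`) then `x ↦ a x + e x` is strictly convex ccw whenever the coordinates of `e` are at
most `ε = min 1 (m / (64 M + 32))`, `M = Σ_x (|a x 0| + |a x 1|)`. [folklore] -/
theorem StrictlyConvexCcw.add_small {a : ZMod q → (Fin 2 → ℝ)} {m : ℝ} (hm : 0 < m)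
    (hmarg : ∀ z x : ZMod q, x ≠ z → x ≠ z + 1 → m ≤ cross2 (a (z + 1) - a z) (a x - a z))
    (e : ZMod q → (Fin 2 → ℝ))
    (he : ∀ y i, |e y i| ≤ min 1 (m / (64 * (∑ y : ZMod q, (|a y 0| + |a y 1|)) + 32))) :
    StrictlyConvexCcw fun x => a x + e x := by
  set M := ∑ y : ZMod q, (|a y 0| + |a y 1|) with hM
  set ε := min 1 (m / (64 * M + 32)) with hε
  have hM0 : 0 ≤ M := Finset.sum_nonneg fun y _ => by positivity
  have hε0 : 0 ≤ ε := le_min zero_le_one (div_nonneg hm.le (by positivity))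
  have hε1 : ε ≤ 1 := min_le_left _ _
  have hεm : ε * (64 * M + 32) ≤ m := by
    have : ε ≤ m / (64 * M + 32) := min_le_right _ _
    rwa [le_div_iff₀ (by positivity)] at this
  intro z x hx0 hx1
  have key := cross2_add_add_ge (a (z + 1) - a z) (a x - a z) (e (z + 1) - e z) (e x - e z)
  have eq : (a (z + 1) + e (z + 1)) - (a z + e z) = (a (z + 1) - a z) + (e (z + 1) - e z) := by abel
  have eq' : (a x + e x) - (a z + e z) = (a x - a z) + (e x - e z) := by abel
  simp only [eq, eq']
  -- coordinate bounds
  have hd : ∀ i, |(a (z + 1) - a z) i| ≤ 2 * M := fun i => by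
    rw [Pi.sub_apply]
    have := abs_sub (a (z + 1) i) (a z i)
    linarith [abs_apply_le_mass a (z + 1) i, abs_apply_le_mass a z i]
  have hv : ∀ i, |(a x - a z) i| ≤ 2 * M := fun i => by
    rw [Pi.sub_apply]
    have := abs_sub (a x i) (a z i)
    linarith [abs_apply_le_mass a x i, abs_apply_le_mass a z i]
  have hδ : ∀ y y' : ZMod q, ∀ i, |(e y - e y') i| ≤ 2 * ε := fun y y' i => by
    rw [Pi.sub_apply]
    have := abs_sub (e y i) (e y' i)
    linarith [he y i, he y' i]
  have h1 : (|(a (z + 1) - a z) 0| + |(a (z + 1) - a z) 1|) * (|(e x - e z) 0| + |(e x - e z) 1|) ≤ 4 * M * (4 * ε) := by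
    apply mul_le_mul (by linarith [hd 0, hd 1]) (by linarith [hδ x z 0, hδ x z 1]) (by positivity) (by positivity)
  have h2 : (|(e (z + 1) - e z) 0| + |(e (z + 1) - e z) 1|) * (|(a x - a z) 0| + |(a x - a z) 1|) ≤ 4 * ε * (4 * M) := by
    apply mul_le_mul (by linarith [hδ (z + 1) z 0, hδ (z + 1) z 1]) (by linarith [hv 0, hv 1]) (by positivity) (by positivity)
  have h3 : (|(e (z + 1) - e z) 0| + |(e (z + 1) - e z) 1|) * (|(e x - e z) 0| + |(e x - e z) 1|) ≤ 4 * ε * (4 * ε) := by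
    apply mul_le_mul (by linarith [hδ (z + 1) z 0, hδ (z + 1) z 1]) (by linarith [hδ x z 0, hδ x z 1]) (by positivity) (by positivity)
  have hεε : ε * ε ≤ ε := by nlinarith
  have hm' := hmarg z x hx0 hx1
  nlinarith

/-- **The convexity margin** of a strictly convex ccw polygon (`q ≥ 3`) is positive. [folklore] -/
theorem exists_margin {a : ZMod q → (Fin 2 → ℝ)} (ha : StrictlyConvexCcw a) (hq : 3 ≤ q) :
    ∃ m : ℝ, 0 < m ∧ ∀ z x : ZMod q, x ≠ z → x ≠ z + 1 → m ≤ cross2 (a (z + 1) - a z) (a x - a z) := by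
  classical
  set S := (Finset.univ : Finset (ZMod q × ZMod q)).filter fun zx => zx.2 ≠ zx.1 ∧ zx.2 ≠ zx.1 + 1 with hS
  have hne : S.Nonempty := by
    refine ⟨(0, 2), Finset.mem_filter.2 ⟨Finset.mem_univ _, two_ne_zero_of_three_le hq, ?_⟩⟩
    rw [zero_add]
    intro h
    exact one_ne_zero_of_three_le hq (by linear_combination h)
  obtain ⟨zx₀, hzx₀, hmin⟩ := Finset.exists_min_image S (fun zx => cross2 (a (zx.1 + 1) - a zx.1) (a zx.2 - a zx.1)) hne
  obtain ⟨-, h1, h2⟩ := Finset.mem_filter.1 hzx₀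
  refine ⟨_, ha zx₀.1 zx₀.2 h1 h2, fun z x hx0 hx1 => hmin (z, x) (Finset.mem_filter.2 ⟨Finset.mem_univ _, hx0, hx1⟩)⟩

/-- **The convex-fibre stratum is open around `(a, 0)`**: for a strictly convex ccw `a` (`q ≥ 3`) there is `ε > 0` such that every partner
`b` with coordinates `≤ ε` gives strictly convex ccw fibres AND anti-fibres. [folklore] -/
theorem exists_eps_fibres_convex {a : ZMod q → (Fin 2 → ℝ)} (ha : StrictlyConvexCcw a) (hq : 3 ≤ q) :
    ∃ ε : ℝ, 0 < ε ∧ ∀ b : ZMod q → (Fin 2 → ℝ), (∀ y i, |b y i| ≤ ε) →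
      (∀ r, StrictlyConvexCcw (fibreCurve a b r)) ∧ (∀ κ, StrictlyConvexCcw (antiFibre a b κ)) := by
  obtain ⟨m, hm, hmarg⟩ := exists_margin ha hq
  set M := ∑ y : ZMod q, (|a y 0| + |a y 1|) with hM
  have hM0 : 0 ≤ M := Finset.sum_nonneg fun y _ => by positivity
  refine ⟨min 1 (m / (64 * M + 32)), lt_min one_pos (div_pos hm (by positivity)), fun b hb => ⟨fun r => ?_, fun κ => ?_⟩⟩
  · exact StrictlyConvexCcw.add_small hm hmarg (fun x => b (r - x)) fun y i => hb _ _
  · have h := StrictlyConvexCcw.add_small hm hmarg (fun x => -b (x + κ)) fun y i => by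
      rw [Pi.neg_apply, abs_neg]; exact hb _ _
    have e : (fun x => a x + -b (x + κ)) = antiFibre a b κ := by
      funext x; simp [antiFibre, sub_eq_add_neg]
    rwa [e] at h

/-- **THE CO-ORIENTED POINTWISE LAW FOR A SMALL PARTNER** (dominant regime): for a strictly convex ccw `a` (`q ≥ 3`) there is `ε > 0` such that
for every `b` with coordinates `≤ ε` and EVERY strictly convex ccw `c`: `∃ μ₀, ∀ μ ≥ μ₀, ∀ s, V_s(a, b, μ•c) ≤ 4q`. [folklore] -/
theorem classVert_smallPartner_smul_le {a : ZMod q → (Fin 2 → ℝ)} (ha : StrictlyConvexCcw a) (hq : 3 ≤ q) :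
    ∃ ε : ℝ, 0 < ε ∧ ∀ b : ZMod q → (Fin 2 → ℝ), (∀ y i, |b y i| ≤ ε) → ∀ c : ZMod q → (Fin 2 → ℝ), StrictlyConvexCcw c →
      ∃ μ₀ : ℝ, ∀ μ : ℝ, μ₀ ≤ μ → ∀ s : ZMod q, classVert a b (μ • c) s ≤ 4 * q := by
  obtain ⟨ε, hε, h⟩ := exists_eps_fibres_convex ha hq
  refine ⟨ε, hε, fun b hb c hc => ?_⟩
  obtain ⟨hF, hG⟩ := h b hb
  exact classVert_antiFibre_smul_le hq hc hF hG

end SmallPartner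

end TotalsLaw

end Summit.ValiantsHypothesis.ValiantsHypothesis.Theorems.NewtonUnitEquationsDissociatedUniform
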